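import Summits.Ventures.PercRepro.Night2LocalD3ZeroFat
import Summits.Ventures.PercRepro.Night2LocalD3Coloops
import Summits.Ventures.PercRepro.Night2SixFourReduction

/-!
# PercRepro — the `(6, 4)` shadow row after the coloop-free cell: the exact open set (night-2, gen 12)

* **`localShadowHall_d3_of_kColoops_one_two`**: the regime `|E ∖ G| = 3` at `q = 4` for loopless simple `M` reduces to
  the flats with `1 ≤ kColoops G ≤ 2` (`kColoops = 0` is `localShadowHall_d3_zero`, `kColoops ≥ 3` is
  `localShadowHall_d3_of_three_le_kColoops`);
* **`shadowHall_six_four_of_local_two_and_three_k12`**: the `(6, 4)` shadow row for EVERY finite matroid, modulo the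
  local form at `|E ∖ G| = 2` and at `|E ∖ G| = 3` with `1 ≤ kColoops ≤ 2`, of loopless simple rank-`6` matroids —
  the exact open set of the row after this generation (`shadowHall_six_four_of_local_two_three` of gen 11 sharpened).
-/

open scoped Matroid

namespace PercRepro.Shadow

open Finset PerFlat ThmH

variable {α : Type*} [DecidableEq α] {M : Matroid α} [M.Finite]

section DThree

variable {G : Finset α}

/-- **The regime `|E ∖ G| = 3` at `q = 4` reduces to `1 ≤ kColoops G ≤ 2`** (loopless simple `M`): the flats without
coloops are `localShadowHall_d3_zero`, those with `≥ 3` coloops have only layer-0 members. -/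
theorem localShadowHall_d3_of_kColoops_one_two (hs : ∀ e ∈ gr M, ∀ f ∈ gr M, e ≠ f → rkN M {e, f} = 2)
    (hl : ∀ e ∈ gr M, M.Indep {e})
    (hloc : ∀ G ∈ flatsQ M (4 + 1), (gr M \ G).card = 3 → 1 ≤ kColoops M G → kColoops M G ≤ 2 →
      LocalShadowHall M 4 G)
    (hG : G ∈ flatsQ M (4 + 1)) (hd : (gr M \ G).card = 3) : LocalShadowHall M 4 G := by
  rcases Nat.lt_or_ge (kColoops M G) 1 with h0 | h1
  · exact localShadowHall_d3_zero hs hl hG hd (by omega)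
  · rcases Nat.lt_or_ge (kColoops M G) 3 with h2 | h3
    · exact hloc G hG hd h1 (by omega)
    · exact localShadowHall_d3_of_three_le_kColoops hG hd h3

end DThree

section SixFour

variable {α' : Type} [DecidableEq α']

/-- **THE `(6, 4)` SHADOW ROW FOR EVERY FINITE MATROID, MODULO `|E ∖ G| = 2` AND THE TWO COLOOP COUNTS `k ∈ {1, 2}`
AT `|E ∖ G| = 3`** of loopless simple rank-`6` matroids — the exact open set of the row after the coloop-free cell. -/
theorem shadowHall_six_four_of_local_two_and_three_k12
    (hloc2 : ∀ (N : Matroid α') [N.Finite], (∀ e ∈ gr N, ∀ f ∈ gr N, e ≠ f → rkN N {e, f} = 2) →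
      (∀ e ∈ gr N, N.Indep {e}) → N.eRank = ((6 : ℕ) : ℕ∞) →
      ∀ G ∈ flatsQ N (4 + 1), (gr N \ G).card = 2 → LocalShadowHall N 4 G)
    (hloc3 : ∀ (N : Matroid α') [N.Finite], (∀ e ∈ gr N, ∀ f ∈ gr N, e ≠ f → rkN N {e, f} = 2) →
      (∀ e ∈ gr N, N.Indep {e}) → N.eRank = ((6 : ℕ) : ℕ∞) →
      ∀ G ∈ flatsQ N (4 + 1), (gr N \ G).card = 3 → 1 ≤ kColoops N G → kColoops N G ≤ 2 → LocalShadowHall N 4 G)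
    (M : Matroid α') [M.Finite] : ShadowHall M 6 4 (phiK 6 4) := by
  apply shadowHall_six_four_of_local_two_three
  intro N _ hs hl hN G hG h2 h3
  rcases Nat.lt_or_ge (gr N \ G).card 3 with hlt | hge
  · exact hloc2 N hs hl hN G hG (by omega)
  · exact localShadowHall_d3_of_kColoops_one_two hs hl (hloc3 N hs hl hN) hG (by omega)

end SixFour

end PercRepro.Shadow
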